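import Literature.NumberTheory.EllipticCurves.Disegni2017.BaseChangeDirichletSplitValuesProofs
import Literature.NumberTheory.EllipticCurves.Disegni2017.CyclotomicLinePointsProofs
import Literature.NumberTheory.EllipticCurves.PAdicLFunctionNeZeroHoldsProofs
import Literature.NumberTheory.EllipticCurves.PAdicLFunctionZeroAtMinusTwoProofs
import HarnessLib

/-!
# Road (C) `disegni-pair-two` on crux stmt-BirchSwinnertonDyer-20368 — STEP A₂: Disegni's interpolation
# VALUES on the `χ₈ ∘ N`-line at `p = 2` are a constant times two Mazur–Tate–Teitelbaum values

Cell `bsd-print-cf2` (`run/shared/lean/pub/bsd-print-cf2/`), width seat `bsd-line-cf2-p1-w8` g21, for the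
planner's PREGRADE §5 (2026-08-30): «Disegni's line function on the χ-line of (V_{d′}, χ = ε_{d*}∘N_{E′})
interpolates L(V_{d′}, ε_{d*}χ^s)·L(V_{d′}, ε_{d*}ε_{E′}χ^s) … state this FACTORISATION as its own lemma
(the addord cluster treats the analogous 𝟙-line factorisation as a THEOREM to prove, not a print)».
THEOREMS ONLY (no `def`, no named fact, no `sorry`); `--supports stmt-BirchSwinnertonDyer-20368`. BSD is
not proved by any of this and no summit statement is claimed: this is the `p = 2` twin of the addord
seat's STEP A (`Summit.BirchSwinnertonDyer.Rank1Residual.Additive.cycLineValue_eq_const_mul_branchValues`,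
odd `p`, the `𝟙_K`-line in the RAMIFIED-`α` frame) on the typer's `χ`-LINE
(`Disegni2017.ChiLineInterpolation`, UNRAMIFIED `α`, `Literature/…/Disegni2017/ChiLineRankinSelberg.lean`)
through `χ = χ₈ ∘ N_{K/ℚ} = baseChangeDirichlet K χ₈` — the one of the three road-(C) twisting characters
`ε_{d*}`, `d* ∈ {−1, 2, −2}`, that is EVEN (`d* = 2`), hence reachable by the tree's Mazur–Tate–Teitelbaum
objects, which carry the PLUS modular symbol only (`PAdicLFunctionBranch.lean`: odd branches need
`[·]⁻`, `Ω⁻`, deliberately absent).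

## What is proved

§1 (any `p` split in the quadratic `K`, `p𝒪_K = 𝔭𝔭′`, unit root `α ∈ ℚ_p` read in `ℂ` as
`a = ι(α)`, two RATIONAL newforms `f`, `f′`):
* `chiLineComplexPart_eq_of_isPrimitive` — at a RAMIFIED point `ξ` (primitive, even, mod `p^n`,
  `n ≥ 1`): `ι⁻¹(Z°_p(ξ∘N) · Car · Λ₁(1)Λ₂(1)) = c · v_f(χ_ξ) · v_{f′}(χ_ξ)` with
  `c = ι⁻¹(u·Car·Ω⁺_f·Ω⁺_{f′})`, `v_g(χ_ξ) = α^{−n} Σ_b χ_ξ(b)[b/p^n]⁺_g` (`ratTwistedSymbolSum g χ_ξ`, the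
  right-hand side of the tree's `hasSum_coeff_padicLFunction_unitRoot`), `χ_ξ` the `ℂ_p`-twin of `ξ`
  (`CyclotomicLinePointsProofs`), for ANY entire continuations `Λ₁`, `Λ₂` of `L(f ⊗ ξ, s)`,
  `L(f′ ⊗ ξ, s)` — from `zCirc_baseChangeDirichlet_of_isPrimitive` (`Z°_p = u·a^{−2n}τ(ξ⁻¹)²`) and Birch's
  formula `ratTwistedSymbolSum_mul_plusPeriod_holds` at `ξ⁻¹`;
* `chiLineComplexPart_one` — at the TRIVIAL character (`p ∤ N`): `ι⁻¹(Z°_p(𝟙_K)·Car·Λ₁(1)Λ₂(1)) =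
  c · (1−α⁻¹)²[0]⁺_f · (1−α⁻¹)²[0]⁺_{f′}` (the constant terms of the two MTT functions,
  `constantCoeff_padicLFunction_unitRoot`), `Λ₁`, `Λ₂` continuing `L(f,s)`, `L(f′,s)` — from
  `zCirc_one_of_not_dvd` (`u·(1−a⁻¹)⁴`) and Birch at the trivial character.
(The `p = 2` bookkeeping and STEP A₂ proper are in the sibling file `…ChiLineValuesTwo.lean`:)
§2 (`p = 2`, the points of the `χ₈∘N`-line): the character bookkeeping of the typed range «`θ` mod
`2^{m+1}` even, of `2`-power order, primitive unless `m = 0`»: `m = 0 ⇒ θ = 1`; no even primitive `θ`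
mod `4`; even primitive mod `8 ⇒ θ = χ₈`; for `m ≥ 3`, `ξ := θ·χ₈` is primitive mod `2^{m+1}`; the line
character at `θ` is `χ₈∘N · θ∘N = ξ∘N` (`baseChangeDirichlet_mul_changeLevel`), `= 𝟙` at `θ = χ₈`; and
the POINTS: `cycLinePoint ι ξ = −cycLinePoint ι θ − 2` (`χ₈(5) = −1`: the `χ₈`-coset of the cyclotomic
variable is the reflection `T ↦ −T−2` of the open disc, `‖2‖₂ < 1`).
§3 (`p = 2`, STEP A₂ proper): `chiLineValue` at the three kinds of points, `= c ·` (MTT value of `f`) `·`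
(MTT value of `f′`): `chiLineValue_chi8_level_two` (`θ = 1`: both factors at the conductor-`8` point
`T = −2`), `chiLineValue_chi8_self` (`θ = χ₈`: both factors at `T = 0`, Euler factors `(1−α⁻¹)²`),
`chiLineValue_chi8_of_three_le` (`m ≥ 3`: both factors at `χ_ξ(γ) − 1 = −(pt θ) − 2`).

Next files: STEP B₂(1) (Artin formalism `rankinSelbergEulerProductHecke_baseChangeDirichlet_eq_holds` +
continuations ⇒ `G` at `pt θ` equals `c·v·v′`) and STEP B₂(2) (re-centring `PAdicPowerSeriesRecenterProofs`
+ uniqueness ⇒ `G(T) = c · L₂(f,α)(−T−2) · L₂(f′,α)(−T−2)`).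

References: [Disegni2017] Thm. A (arXiv v3 PDF pp. 6–7); [MazurTateTeitelbaum1986Invent] §I.8 (8.6),
§I.13, §I.14 (14.3); [Gross2004] §3, §13; cell PREGRADE `bsd-print-cf2-plan/PREGRADE-disegni-pair-two-skeleton-g24.md` §5.
-/

set_option autoImplicit false
set_option linter.dupNamespace false

noncomputable section

open scoped Classical MatrixGroups ModularForm NumberField

open CongruenceSubgroup NumberField IsDedekindDomain Literature.NumberTheory.EllipticCurves
  Literature.NumberTheory.EllipticCurves.ModularForms
  Literature.NumberTheory.EllipticCurves.Disegni2017 Literature.NumberTheory.GaloisRepresentations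

namespace Summit.BirchSwinnertonDyer.BirchSwinnertonDyer.Theorems.PrintCf2.DisegniPairTwo

/-! ### §1 The two value identities at a split prime (any `p`) -/

section AnyPrime

variable {p : ℕ} [hp : Fact p.Prime] (ι : PadicAlgCl p ≃+* ℂ)
  (K : Type) [Field K] [NumberField K] [IsGalois ℚ K]

/-- **Transport of a twisted symbol sum along `ι⁻¹`**: `ι⁻¹(Σ_b ξ⁻¹(b)[b/m]⁺_g) = Σ_b χ_ξ(b)[b/m]⁺_g` in
`ℂ_p`, `χ_ξ = (ξ⁻¹ ∘ ι⁻¹)` the `ℂ_p`-twin of `ξ` (the symbols `[b/m]⁺_g` are RATIONAL).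
[cite: MazurTateTeitelbaum1986Invent, §I.8 (8.6) and §I.13] -/
theorem coe_symm_ratTwistedSymbolSum_inv {m : ℕ} [NeZero m] {N : ℕ} (g : CuspForm (Gamma0 N) 2)
    (ξ : DirichletCharacter ℂ m) :
    ((ι.symm (ratTwistedSymbolSum g ξ⁻¹) : PadicAlgCl p) : ℂ_[p]) =
      ratTwistedSymbolSum g
        ((ξ⁻¹.ringHomComp ι.symm.toRingHom).ringHomComp (algebraMap (PadicAlgCl p) ℂ_[p])) := by
  rw [ratTwistedSymbolSum, ratTwistedSymbolSum, map_sum, PadicComplex.coe_eq, map_sum]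
  refine Finset.sum_congr rfl fun b _ ↦ ?_
  rw [map_mul, map_mul, MulChar.ringHomComp_apply, MulChar.ringHomComp_apply, map_ratCast,
    map_ratCast]
  rfl

/-- The inverse of a primitive character is primitive (same conductor). [folklore] -/
private theorem isPrimitive_inv' {m : ℕ} [NeZero m] {ξ : DirichletCharacter ℂ m} (hξ : ξ.IsPrimitive) :
    ξ⁻¹.IsPrimitive := by
  rw [DirichletCharacter.isPrimitive_def, DirichletCharacter.conductor_inv]
  exact hξ

/-- The inverse of an even character is even. [folklore] -/
private theorem even_inv' {m : ℕ} {ξ : DirichletCharacter ℂ m} (hξ : ξ.Even) : ξ⁻¹.Even := by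
  rw [DirichletCharacter.Even, MulChar.inv_apply_eq_inv', hξ, inv_one]

/-- `ι⁻¹(ι(α)⁻¹ ^ n) = α⁻¹ ^ n` read in `ℂ_p` (`α ∈ ℚ_p`). [folklore] -/
private theorem coe_symm_inv_pow (α : ℚ_[p]) (n : ℕ) :
    ((ι.symm ((ι ((α : PadicAlgCl p)))⁻¹ ^ n) : PadicAlgCl p) : ℂ_[p]) =
      algebraMap ℚ_[p] ℂ_[p] (α⁻¹ ^ n) := by
  rw [map_pow, map_inv₀, RingEquiv.symm_apply_apply, PadicComplex.coe_eq, map_pow, map_inv₀,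
    map_pow, map_inv₀]
  change ((algebraMap (PadicAlgCl p) ℂ_[p]) ((algebraMap ℚ_[p] (PadicAlgCl p)) α))⁻¹ ^ n = _
  rw [← IsScalarTower.algebraMap_apply]

/-- ★ **STEP A at a RAMIFIED point of a base-change line** (`p` split in the quadratic `K`, `𝔭, 𝔭′ ∋ p`;
`ξ` PRIMITIVE and EVEN mod `p^n`, `n ≥ 1`; `f`, `f′` rational newforms; `α ∈ ℚ_p` the unit-root datum,
`a = ι(α)`): for ANY entire continuations `Λ₁`, `Λ₂` of `L(f ⊗ ξ, s)`, `L(f′ ⊗ ξ, s)`,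
`ι⁻¹( Z°_p(ξ∘N) · Car · Λ₁(1)Λ₂(1) ) = ι⁻¹(u·Car·Ω⁺_f·Ω⁺_{f′}) · (α^{−n}Σ_b χ_ξ(b)[b/p^n]⁺_f) ·
(α^{−n}Σ_b χ_ξ(b)[b/p^n]⁺_{f′})` — Disegni's `Z°_p = u·a^{−2n}·τ(ξ⁻¹)²`
(`zCirc_baseChangeDirichlet_of_isPrimitive`), Birch's formula at `ξ⁻¹` (`τ(ξ⁻¹)Λ_i(1) = Σ_b ξ⁻¹(b)[b/p^n]⁺Ω⁺`),
transport along `ι⁻¹`. The right-hand factors are EXACTLY the values of the tree's Mazur–Tate–Teitelbaum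
interpolation theorem `hasSum_coeff_padicLFunction_unitRoot` at the twin `χ_ξ`.
[cite: Disegni2017, Theorem A (arXiv v3 PDF p. 6 L42–59, p. 7 L1–6)]
[cite: MazurTateTeitelbaum1986Invent, §I.8 (8.6), §I.14 (14.3)] -/
theorem chiLineComplexPart_eq_of_isPrimitive (h2 : Module.finrank ℚ K = 2)
    (hsplit : ((Ideal.span {(p : ℤ)}).primesOver (𝓞 K)).ncard = 2)
    (𝔭 𝔭' : HeightOneSpectrum (𝓞 K)) (h𝔭 : ((p : ℕ) : 𝓞 K) ∈ 𝔭.asIdeal)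
    (h𝔭' : ((p : ℕ) : 𝓞 K) ∈ 𝔭'.asIdeal) {n : ℕ} (hn : 0 < n) [NeZero (p ^ n)]
    {ξ : DirichletCharacter ℂ (p ^ n)} (hξ : ξ.IsPrimitive) (hξe : ξ.Even)
    {N N' : ℕ} [NeZero N] [NeZero N'] {f : CuspForm (Gamma0 N) 2} {f' : CuspForm (Gamma0 N') 2}
    (hf : IsNewform0 f) (hQ : coeffField f = ⊥) (hf' : IsNewform0 f') (hQ' : coeffField f' = ⊥)
    (α : ℚ_[p]) (Car : ℝ) {Λ₁ Λ₂ : ℂ → ℂ} (hΛ₁ : Differentiable ℂ Λ₁)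
    (hΛ₁' : ∀ s : ℂ, 2 < s.re → Λ₁ s = twistedLSeries f ξ s) (hΛ₂ : Differentiable ℂ Λ₂)
    (hΛ₂' : ∀ s : ℂ, 2 < s.re → Λ₂ s = twistedLSeries f' ξ s) :
    ((ι.symm (zCirc (p := p) (ι ((α : PadicAlgCl p))) N (baseChangeDirichlet K ξ) 𝔭 𝔭' * (Car : ℂ) *
        (Λ₁ 1 * Λ₂ 1)) : PadicAlgCl p) : ℂ_[p]) =
      ((ι.symm ((splitLocalConstant p : ℂ) * (Car : ℂ) * (plusPeriod f : ℂ) * (plusPeriod f' : ℂ)) :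
          PadicAlgCl p) : ℂ_[p]) *
        (algebraMap ℚ_[p] ℂ_[p] (α⁻¹ ^ n) *
          ratTwistedSymbolSum f
            ((ξ⁻¹.ringHomComp ι.symm.toRingHom).ringHomComp (algebraMap (PadicAlgCl p) ℂ_[p]))) *
        (algebraMap ℚ_[p] ℂ_[p] (α⁻¹ ^ n) *
          ratTwistedSymbolSum f'
            ((ξ⁻¹.ringHomComp ι.symm.toRingHom).ringHomComp (algebraMap (PadicAlgCl p) ℂ_[p]))) := by
  set a : ℂ := ι ((α : PadicAlgCl p)) with ha
  set τ : ℂ := gaussSum ξ⁻¹ (ZMod.stdAddChar (N := p ^ n)) with hτ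
  -- Birch's formula at the even primitive character `ξ⁻¹` (`(ξ⁻¹)⁻¹ = ξ`)
  have hB₁ := ratTwistedSymbolSum_mul_plusPeriod_holds hf hQ (isPrimitive_inv' hξ) (even_inv' hξe) hΛ₁
    (fun s hs ↦ by rw [inv_inv]; exact hΛ₁' s hs)
  have hB₂ := ratTwistedSymbolSum_mul_plusPeriod_holds hf' hQ' (isPrimitive_inv' hξ) (even_inv' hξe) hΛ₂
    (fun s hs ↦ by rw [inv_inv]; exact hΛ₂' s hs)
  -- the complex identity
  have hC : zCirc (p := p) a N (baseChangeDirichlet K ξ) 𝔭 𝔭' * (Car : ℂ) * (Λ₁ 1 * Λ₂ 1) =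
      ((splitLocalConstant p : ℂ) * (Car : ℂ) * (plusPeriod f : ℂ) * (plusPeriod f' : ℂ)) *
        (a⁻¹ ^ n * ratTwistedSymbolSum f ξ⁻¹) * (a⁻¹ ^ n * ratTwistedSymbolSum f' ξ⁻¹) := by
    rw [zCirc_baseChangeDirichlet_of_isPrimitive h2 hsplit hn hξ a N 𝔭 𝔭' h𝔭 h𝔭', ← hτ]
    calc (splitLocalConstant p : ℂ) * (a⁻¹ ^ n * τ) ^ 2 * (Car : ℂ) * (Λ₁ 1 * Λ₂ 1)
        = (splitLocalConstant p : ℂ) * (Car : ℂ) * (a⁻¹ ^ n) ^ 2 * (τ * Λ₁ 1) * (τ * Λ₂ 1) := by ring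
      _ = (splitLocalConstant p : ℂ) * (Car : ℂ) * (a⁻¹ ^ n) ^ 2 *
            (ratTwistedSymbolSum f ξ⁻¹ * (plusPeriod f : ℂ)) *
            (ratTwistedSymbolSum f' ξ⁻¹ * (plusPeriod f' : ℂ)) := by rw [hB₁, hB₂]
      _ = _ := by ring
  -- push `ι⁻¹` and the embedding `ℚ̄_p → ℂ_p` through the products
  have hφ : ∀ x y : ℂ, ((ι.symm (x * y) : PadicAlgCl p) : ℂ_[p]) =
      ((ι.symm x : PadicAlgCl p) : ℂ_[p]) * ((ι.symm y : PadicAlgCl p) : ℂ_[p]) := fun x y ↦ by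
    rw [map_mul, PadicComplex.coe_eq, map_mul, ← PadicComplex.coe_eq, ← PadicComplex.coe_eq]
  rw [hC, hφ _ (a⁻¹ ^ n * ratTwistedSymbolSum f' ξ⁻¹), hφ _ (a⁻¹ ^ n * ratTwistedSymbolSum f ξ⁻¹),
    hφ (a⁻¹ ^ n) (ratTwistedSymbolSum f ξ⁻¹), hφ (a⁻¹ ^ n) (ratTwistedSymbolSum f' ξ⁻¹), ha,
    coe_symm_inv_pow, coe_symm_ratTwistedSymbolSum_inv, coe_symm_ratTwistedSymbolSum_inv]

/-- `gaussSum 𝟙 ψ⁰ = 1` for the trivial character modulo `1`. [folklore] -/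
private theorem gaussSum_one_level_one :
    gaussSum (1 : DirichletCharacter ℂ 1) (ZMod.stdAddChar (N := 1)) = 1 := by
  rw [gaussSum, Fintype.sum_unique, MulChar.one_apply (isUnit_of_subsingleton _), one_mul]
  have h0 : ∀ x : ZMod 1, ZMod.stdAddChar (N := 1) x = 1 := fun x ↦ by
    rw [Subsingleton.elim x 0, AddChar.map_zero_eq_one]
  exact h0 _

/-- `Σ_{a mod 1} 𝟙(a)[a/1]⁺_g = [0]⁺_g`. [folklore] -/
private theorem ratTwistedSymbolSum_one_level_one {N : ℕ} (g : CuspForm (Gamma0 N) 2) :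
    ratTwistedSymbolSum g (1 : DirichletCharacter ℂ 1) = (ratPlusSymbol g 0 : ℂ) := by
  rw [ratTwistedSymbolSum, Fintype.sum_unique, MulChar.one_apply (isUnit_of_subsingleton _), one_mul]
  have h0 : ∀ x : ZMod 1, ((x.val : ℚ) / ((1 : ℕ) : ℚ)) = 0 := fun x ↦ by
    rw [Subsingleton.elim x 0, ZMod.val_zero, Nat.cast_zero, zero_div]
  rw [h0]

/-- `ι(α) ≠ p` for a `p`-adic unit `α` (`‖α‖ = 1 ≠ ‖p‖`). [folklore] -/
private theorem iota_ne_natCast_of_norm_eq_one {α : ℚ_[p]} (hα : ‖α‖ = 1) :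
    ι ((α : PadicAlgCl p)) ≠ (p : ℂ) := by
  intro h
  have h' : (α : PadicAlgCl p) = (p : PadicAlgCl p) := by
    apply ι.injective
    rw [h, map_natCast]
  have hn : ‖(α : PadicAlgCl p)‖ = ‖(p : PadicAlgCl p)‖ := by rw [h']
  have hpn : ‖(p : PadicAlgCl p)‖ = ((p : ℝ))⁻¹ := by
    rw [← map_natCast (algebraMap ℚ_[p] (PadicAlgCl p)), norm_algebraMap', Padic.norm_p]
  have hαn : ‖(α : PadicAlgCl p)‖ = 1 := by
    rw [PadicAlgCl.norm_extends, hα]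
  rw [hαn, hpn] at hn
  have hp1 : (1 : ℝ) < p := by exact_mod_cast hp.out.one_lt
  have : (p : ℝ)⁻¹ < 1 := inv_lt_one_of_one_lt₀ hp1
  exact absurd hn (ne_of_gt this)

omit [IsGalois ℚ K] in
/-- ★ **STEP A at the TRIVIAL character** (`p` split in `K`, `𝔭, 𝔭′` the two places; `p ∤ N`; `α` a
`p`-adic UNIT, `a = ι(α)`): for ANY entire continuations `Λ₁`, `Λ₂` of `L(f, s) = L(f ⊗ 𝟙, s)` and
`L(f′, s)` (trivial character mod `1`), `ι⁻¹( Z°_p(𝟙_K) · Car · Λ₁(1)Λ₂(1) ) = ι⁻¹(u·Car·Ω⁺_f·Ω⁺_{f′}) ·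
(1−α⁻¹)²[0]⁺_f · (1−α⁻¹)²[0]⁺_{f′}` — Disegni's `Z°_p(𝟙) = u·(1−a⁻¹)⁴` (`zCirc_one_of_not_dvd`), Birch at
the trivial character (`[0]⁺_g Ω⁺_g = Λ(1)`). The right-hand factors are EXACTLY the constant terms
`L_p(g, α, 0) = (1−α⁻¹)²[0]⁺_g` of the tree's `constantCoeff_padicLFunction_unitRoot`.
[cite: Disegni2017, Theorem A (arXiv v3 PDF p. 6 L42–57)] [cite: MazurTateTeitelbaum1986Invent, §I.14 (14.3)] -/
theorem chiLineComplexPart_one (𝔭 𝔭' : HeightOneSpectrum (𝓞 K))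
    {N N' : ℕ} [NeZero N] [NeZero N'] (hpN : ¬ p ∣ N) {f : CuspForm (Gamma0 N) 2}
    {f' : CuspForm (Gamma0 N') 2}
    (hf : IsNewform0 f) (hQ : coeffField f = ⊥) (hf' : IsNewform0 f') (hQ' : coeffField f' = ⊥)
    {α : ℚ_[p]} (hα : ‖α‖ = 1) (Car : ℝ) {Λ₁ Λ₂ : ℂ → ℂ} (hΛ₁ : Differentiable ℂ Λ₁)
    (hΛ₁' : ∀ s : ℂ, 2 < s.re → Λ₁ s = twistedLSeries f (1 : DirichletCharacter ℂ 1) s)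
    (hΛ₂ : Differentiable ℂ Λ₂)
    (hΛ₂' : ∀ s : ℂ, 2 < s.re → Λ₂ s = twistedLSeries f' (1 : DirichletCharacter ℂ 1) s) :
    ((ι.symm (zCirc (p := p) (ι ((α : PadicAlgCl p))) N (1 : HeckeCharacter K) 𝔭 𝔭' * (Car : ℂ) *
        (Λ₁ 1 * Λ₂ 1)) : PadicAlgCl p) : ℂ_[p]) =
      ((ι.symm ((splitLocalConstant p : ℂ) * (Car : ℂ) * (plusPeriod f : ℂ) * (plusPeriod f' : ℂ)) :
          PadicAlgCl p) : ℂ_[p]) *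
        algebraMap ℚ_[p] ℂ_[p] ((1 - α⁻¹) ^ 2 * (ratPlusSymbol f 0 : ℚ_[p])) *
        algebraMap ℚ_[p] ℂ_[p] ((1 - α⁻¹) ^ 2 * (ratPlusSymbol f' 0 : ℚ_[p])) := by
  set a : ℂ := ι ((α : PadicAlgCl p)) with ha
  haveI : NeZero (1 : ℕ) := ⟨one_ne_zero⟩
  -- Birch's formula at the trivial character mod `1`
  have h1prim : (1 : DirichletCharacter ℂ 1).IsPrimitive := DirichletCharacter.isPrimitive_one_level_one
  have h1even : (1 : DirichletCharacter ℂ 1).Even := MulChar.one_apply (isUnit_of_subsingleton _)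
  have hB₁ := ratTwistedSymbolSum_mul_plusPeriod_holds hf hQ h1prim h1even hΛ₁
    (fun s hs ↦ by rw [inv_one]; exact hΛ₁' s hs)
  have hB₂ := ratTwistedSymbolSum_mul_plusPeriod_holds hf' hQ' h1prim h1even hΛ₂
    (fun s hs ↦ by rw [inv_one]; exact hΛ₂' s hs)
  rw [gaussSum_one_level_one, one_mul, ratTwistedSymbolSum_one_level_one] at hB₁ hB₂
  -- the complex identity
  have hC : zCirc (p := p) a N (1 : HeckeCharacter K) 𝔭 𝔭' * (Car : ℂ) * (Λ₁ 1 * Λ₂ 1) =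
      ((splitLocalConstant p : ℂ) * (Car : ℂ) * (plusPeriod f : ℂ) * (plusPeriod f' : ℂ)) *
        ((1 - a⁻¹) ^ 2 * (ratPlusSymbol f 0 : ℂ)) * ((1 - a⁻¹) ^ 2 * (ratPlusSymbol f' 0 : ℂ)) := by
    rw [zCirc_one_of_not_dvd a (iota_ne_natCast_of_norm_eq_one ι hα) hpN 𝔭 𝔭', ← hB₁, ← hB₂]
    ring
  have hfac : ((ι.symm ((1 - a⁻¹) ^ 2)) : ℂ_[p]) = algebraMap ℚ_[p] ℂ_[p] ((1 - α⁻¹) ^ 2) := by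
    rw [map_pow, map_sub, map_one, map_inv₀, ha, RingEquiv.symm_apply_apply, PadicComplex.coe_eq,
      map_pow, map_sub, map_one, map_inv₀, map_pow, map_sub, map_one, map_inv₀]
    change (1 - ((algebraMap (PadicAlgCl p) ℂ_[p]) ((algebraMap ℚ_[p] (PadicAlgCl p)) α))⁻¹) ^ 2 = _
    rw [← IsScalarTower.algebraMap_apply]
  have hsym : ∀ r : ℚ, ((ι.symm (r : ℂ)) : ℂ_[p]) = algebraMap ℚ_[p] ℂ_[p] (r : ℚ_[p]) := fun r ↦ by
    rw [map_ratCast, PadicComplex.coe_eq, map_ratCast, map_ratCast]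
  have hφ : ∀ x y : ℂ, ((ι.symm (x * y) : PadicAlgCl p) : ℂ_[p]) =
      ((ι.symm x : PadicAlgCl p) : ℂ_[p]) * ((ι.symm y : PadicAlgCl p) : ℂ_[p]) := fun x y ↦ by
    rw [map_mul, PadicComplex.coe_eq, map_mul, ← PadicComplex.coe_eq, ← PadicComplex.coe_eq]
  rw [hC, hφ _ ((1 - a⁻¹) ^ 2 * (ratPlusSymbol f' 0 : ℂ)), hφ _ ((1 - a⁻¹) ^ 2 * (ratPlusSymbol f 0 : ℂ)),
    hφ ((1 - a⁻¹) ^ 2) (ratPlusSymbol f 0 : ℂ), hφ ((1 - a⁻¹) ^ 2) (ratPlusSymbol f' 0 : ℂ), hfac, hsym,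
    hsym, map_mul (algebraMap ℚ_[p] ℂ_[p]) ((1 - α⁻¹) ^ 2),
    map_mul (algebraMap ℚ_[p] ℂ_[p]) ((1 - α⁻¹) ^ 2)]

end AnyPrime

end Summit.BirchSwinnertonDyer.BirchSwinnertonDyer.Theorems.PrintCf2.DisegniPairTwo

end
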